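import Literature.Analysis.Complex.SlitHalfStripPoisson
import HarnessLib

/-!
# Bounds for the boundary densities of the slit half-strip

Topic `Literature/Analysis/Complex`. Sequel to `SlitHalfStripPoisson`: pointwise bounds for the
densities `ρ₀ = rayDensity r t`, `ρ₁ = lineDensity r t` of the (harmonic-measure-free)
sub-mean-value inequality `log_normSq_add_le_densities` on the slit half-strip
`{|Im z| < r} ∖ (-∞, 0]` seen from the point `t > 0` (`c = π/r`, `A = e^{ct} - 1`):
* `rayDensity_le_inv_sqrt` — `ρ₀(x) ≤ π⁻¹ (2/(t|x|))^{1/2}` for all `x < 0`, uniformly in `r`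
  (the square-root singularity at the tip of the slit, BD18 Lemma 2.13);
* `rayDensity_le_exp` — `ρ₀(x) ≤ r⁻¹ (ct(1-e^{-cℓ}))^{-1/2} e^{-c|x|}` for `x ≤ -ℓ`;
* `lineDensity_le_exp` — `ρ₁(x) ≤ (2r)⁻¹ (1-e^{-ct})^{-1/2} e^{-c|x-t|/2}` (BD18 Lemma 2.14);
together with nonnegativity. J. Bourgain, S. Dyatlov, *Spectral gaps without the pressure
condition*, Ann. of Math. 187 (2018), §2.4.
-/

noncomputable section

namespace Literature.Analysis.Complex

open Real Set MeasureTheory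

/-- `1 - e^{-y} ≥ y/(1+y)` for `y ≥ 0`. [folklore] -/
theorem div_one_add_le_one_sub_exp_neg {y : ℝ} (hy : 0 ≤ y) : y / (1 + y) ≤ 1 - Real.exp (-y) := by
  have h1 : 1 + y ≤ Real.exp y := by linarith [Real.add_one_le_exp y]
  have h2 : Real.exp (-y) ≤ 1 / (1 + y) := by
    rw [Real.exp_neg, one_div]
    exact inv_anti₀ (by linarith) h1
  have h3 : y / (1 + y) = 1 - 1 / (1 + y) := by field_simp; ring
  linarith [h3]

/-- `e^u - 1 ≥ u`. [folklore] -/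
theorem le_exp_sub_one (u : ℝ) : u ≤ Real.exp u - 1 := by linarith [Real.add_one_le_exp u]

section bounds

variable {r t : ℝ} (hr : 0 < r) (ht : 0 < t)
include hr ht

/-- `ρ₀ ≥ 0` on `x < 0`. [folklore] -/
theorem rayDensity_nonneg {x : ℝ} (hx : x < 0) : 0 ≤ rayDensity r t x := by
  have hA := slitStripA_pos hr ht
  have hS := rayParam_pos hA (by positivity : 0 < π / r) hx
  unfold rayDensity
  positivity

/-- `ρ₁ ≥ 0`. [folklore] -/
theorem lineDensity_nonneg (x : ℝ) : 0 ≤ lineDensity r t x := by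
  have hA := slitStripA_pos hr ht
  have hT := lineParam_pos hA (c := π / r) x
  unfold lineDensity
  positivity

/-- `ρ₀(x)² ≤ e^{2cx}/(r² A (1 - e^{cx}))` (`c = π/r`): drop the factor `1 + S²` and square.
[folklore] -/
theorem rayDensity_sq_le_aux {x : ℝ} (hx : x < 0) :
    rayDensity r t x ^ 2 ≤ Real.exp (π / r * x) ^ 2 /
      (r ^ 2 * (slitStripA r t * (1 - Real.exp (π / r * x)))) := by
  have hA := slitStripA_pos hr ht
  set c : ℝ := π / r with hc
  have hc0 : 0 < c := by positivity
  set S := rayParam (slitStripA r t) c x with hSdef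
  have hS : 0 < S := rayParam_pos hA hc0 hx
  have hSsq : S ^ 2 = (1 - Real.exp (c * x)) / slitStripA r t := rayParam_sq hA hc0 hx
  have h1e := (one_sub_exp_mem hc0 hx).1
  have h1 : rayDensity r t x ≤ 1 / r * Real.exp (c * x) / (slitStripA r t * S) := by
    unfold rayDensity
    rw [← hSdef]
    apply div_le_div_of_nonneg_left (by positivity) (by positivity)
    have : 0 ≤ slitStripA r t * S * S ^ 2 := by positivity
    nlinarith
  have h0 : 0 ≤ rayDensity r t x := rayDensity_nonneg hr ht hx
  have hAS2 : (slitStripA r t * S) ^ 2 = slitStripA r t * (1 - Real.exp (c * x)) := by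
    rw [mul_pow, hSsq]; field_simp
  have hR : (1 / r * Real.exp (c * x) / (slitStripA r t * S)) ^ 2 =
      Real.exp (c * x) ^ 2 / (r ^ 2 * (slitStripA r t * (1 - Real.exp (c * x)))) := by
    rw [div_pow, mul_pow, hAS2]; field_simp
  exact (pow_le_pow_left₀ h0 h1 2).trans_eq hR

/-- **The tip singularity** (BD18 Lemma 2.13, explicit form):
`ρ₀(x)² ≤ 2/(π² t |x|)`, i.e. `ρ₀(x) ≤ π⁻¹(2/(t|x|))^{1/2}`, for all `x < 0`, uniformly in `r`.
[cite: BourgainDyatlov2018, Lemma 2.13] -/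
theorem rayDensity_sq_le {x : ℝ} (hx : x < 0) :
    rayDensity r t x ^ 2 ≤ 2 / (π ^ 2 * t * |x|) := by
  have hA := slitStripA_pos hr ht
  set c : ℝ := π / r with hc
  have hc0 : 0 < c := by positivity
  have h1e := (one_sub_exp_mem hc0 hx).1
  have h2 := rayDensity_sq_le_aux hr ht hx
  rw [← hc] at h2
  -- step 3: the key real inequality, in the variable `y = c|x|`
  set y : ℝ := c * |x| with hy
  have hy0 : 0 < y := mul_pos hc0 (abs_pos.2 hx.ne)
  have hxy : c * x = -y := by rw [hy, abs_of_neg hx]; ring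
  have hA1 : c * t ≤ slitStripA r t := by
    unfold slitStripA; rw [show π * t / r = c * t by rw [hc]; ring]; exact le_exp_sub_one _
  have h1y : y / (1 + y) ≤ 1 - Real.exp (-y) := div_one_add_le_one_sub_exp_neg hy0.le
  have h1y' : y ≤ (1 + y) * (1 - Real.exp (-y)) := by
    have := mul_le_mul_of_nonneg_left h1y (by positivity : (0:ℝ) ≤ 1 + y)
    rwa [mul_div_cancel₀ _ (by positivity : (1:ℝ) + y ≠ 0)] at this
  have h3y : Real.exp (-(2 * y)) * (1 + y) ≤ 1 := by
    have h := Real.add_one_le_exp (2 * y)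
    rw [Real.exp_neg]
    rw [inv_mul_le_iff₀ (Real.exp_pos _)]
    linarith
  have hkey : c * t * y * Real.exp (-(2 * y)) ≤ slitStripA r t * (1 - Real.exp (-y)) := by
    -- `c t y e^{-2y} (1+y) ≤ c t y ≤ c t (1+y)(1-e^{-y}) ≤ A (1+y)(1-e^{-y})`, divide by `1+y`
    have hpos : (0:ℝ) < 1 + y := by positivity
    have hcty : 0 ≤ c * t * y := by positivity
    have step : c * t * y * Real.exp (-(2 * y)) * (1 + y) ≤
        slitStripA r t * (1 - Real.exp (-y)) * (1 + y) := by
      calc c * t * y * Real.exp (-(2 * y)) * (1 + y)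
          = c * t * y * (Real.exp (-(2 * y)) * (1 + y)) := by ring
        _ ≤ c * t * y * 1 := mul_le_mul_of_nonneg_left h3y hcty
        _ ≤ c * t * ((1 + y) * (1 - Real.exp (-y))) := by
            rw [mul_one]; exact mul_le_mul_of_nonneg_left h1y' (by positivity)
        _ ≤ slitStripA r t * ((1 + y) * (1 - Real.exp (-y))) := by
            apply mul_le_mul_of_nonneg_right hA1
            have : 0 ≤ 1 - Real.exp (-y) := by
              have : Real.exp (-y) ≤ 1 := by rw [Real.exp_le_one_iff]; linarith
              linarith
            positivity
        _ = slitStripA r t * (1 - Real.exp (-y)) * (1 + y) := by ring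
    exact le_of_mul_le_mul_right step hpos
  -- step 4: rewrite everything in `y`
  have hexp2 : Real.exp (c * x) ^ 2 = Real.exp (-(2 * y)) := by
    rw [hxy, ← Real.exp_nat_mul]; ring_nf
  have hden : π ^ 2 * t * |x| = r ^ 2 * (c * t * y) := by
    rw [hy, hc]; field_simp
  rw [hden]
  refine h2.trans ?_
  rw [hexp2, hxy]
  have hA2 : 0 < slitStripA r t * (1 - Real.exp (-y)) := by
    rw [← hxy]; exact mul_pos hA h1e
  rw [div_le_div_iff₀ (by positivity) (by positivity)]
  nlinarith [hkey, hr]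

/-- `ρ₀(x) ≤ (2/(π² t|x|))^{1/2}` for `x < 0`. [cite: BourgainDyatlov2018, Lemma 2.13] -/
theorem rayDensity_le_sqrt {x : ℝ} (hx : x < 0) :
    rayDensity r t x ≤ Real.sqrt (2 / (π ^ 2 * t * |x|)) := by
  exact (Real.le_sqrt (rayDensity_nonneg hr ht hx) (by positivity)).2 (rayDensity_sq_le hr ht hx)

/-- **Far from the tip**: for `x ≤ -ℓ < 0`, `ρ₀(x)² ≤ e^{2cx}/(r² c t (1 - e^{-cℓ}))`, `c = π/r`
(exponential decay along the ray). [cite: BourgainDyatlov2018, §2.4] -/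
theorem rayDensity_sq_le_exp {ℓ x : ℝ} (hℓ : 0 < ℓ) (hx : x ≤ -ℓ) :
    rayDensity r t x ^ 2 ≤ Real.exp (π / r * x) ^ 2 /
      (r ^ 2 * (π / r * t * (1 - Real.exp (-(π / r * ℓ))))) := by
  have hA := slitStripA_pos hr ht
  set c : ℝ := π / r with hc
  have hc0 : 0 < c := by positivity
  have hx0 : x < 0 := by linarith
  have h2 := rayDensity_sq_le_aux hr ht hx0
  rw [← hc] at h2
  refine h2.trans ?_
  have hA1 : c * t ≤ slitStripA r t := by
    unfold slitStripA; rw [show π * t / r = c * t by rw [hc]; ring]; exact le_exp_sub_one _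
  have hE : 1 - Real.exp (-(c * ℓ)) ≤ 1 - Real.exp (c * x) := by
    have : Real.exp (c * x) ≤ Real.exp (-(c * ℓ)) := Real.exp_le_exp.2 (by nlinarith)
    linarith
  have hm : 0 < 1 - Real.exp (-(c * ℓ)) := by
    have : Real.exp (-(c * ℓ)) < 1 := by
      rw [← Real.exp_zero]; exact Real.exp_lt_exp.2 (by nlinarith)
    linarith
  apply div_le_div_of_nonneg_left (by positivity) (by positivity)
  apply mul_le_mul_of_nonneg_left _ (by positivity)
  exact mul_le_mul hA1 hE hm.le hA.le

/-- **The lines** (BD18 Lemma 2.14, explicit form):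
`ρ₁(x)² ≤ (2r)⁻² (1 - e^{-ct})⁻¹ e^{-c|x-t|}`, `c = π/r`. [cite: BourgainDyatlov2018, Lemma 2.14] -/
theorem lineDensity_sq_le (x : ℝ) :
    lineDensity r t x ^ 2 ≤ (1 / (2 * r)) ^ 2 * (1 - Real.exp (-(π / r * t)))⁻¹ *
      Real.exp (-(π / r * |x - t|)) := by
  have hA := slitStripA_pos hr ht
  set c : ℝ := π / r with hc
  have hc0 : 0 < c := by positivity
  set E : ℝ := Real.exp (c * x) with hE
  have hE0 : 0 < E := Real.exp_pos _
  set A : ℝ := slitStripA r t with hAdef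
  have hT2 : lineParam A c x ^ 2 = (1 + E) / A := lineParam_sq hA x
  have hT0 : 0 < lineParam A c x := lineParam_pos hA x
  -- `ρ₁² = (2r)⁻² E² A / ((1+E)(A+1+E)²)`
  have hρ : lineDensity r t x ^ 2 = (1 / (2 * r)) ^ 2 * (E ^ 2 * A / ((1 + E) * (A + 1 + E) ^ 2)) := by
    unfold lineDensity
    have hA' : A ≠ 0 := hA.ne'
    rw [← hc, ← hAdef, ← hE, div_pow, mul_pow, mul_pow, mul_pow, hT2]
    field_simp
    ring
  -- `e^{ct} = A + 1`
  have hAt : Real.exp (c * t) = A + 1 := by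
    rw [hAdef]; unfold slitStripA; rw [show π * t / r = c * t by rw [hc]; ring]; ring
  have hm : (1 - Real.exp (-(c * t)))⁻¹ = (A + 1) / A := by
    have hA' : A ≠ 0 := hA.ne'
    have hA1 : A + 1 ≠ 0 := by positivity
    rw [Real.exp_neg, hAt, show (1 : ℝ) - (A + 1)⁻¹ = A / (A + 1) by field_simp; ring, inv_div]
  rw [hρ, hm, mul_assoc]
  apply mul_le_mul_of_nonneg_left _ (by positivity)
  rcases le_or_gt t x with htx | htx
  · -- `x ≥ t`: `e^{-c(x-t)} = (A+1)/E`
    have habs : |x - t| = x - t := abs_of_nonneg (by linarith)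
    have hexp : Real.exp (-(c * |x - t|)) = (A + 1) / E := by
      rw [habs, show -(c * (x - t)) = c * t - c * x by ring, Real.exp_sub, hAt]
    rw [hexp, div_mul_div_comm, div_le_div_iff₀ (by positivity) (by positivity)]
    -- `E² A (A E) ≤ (A+1)(A+1) (1+E)(A+1+E)²`
    have h1 : E ^ 2 ≤ (A + 1 + E) ^ 2 := by nlinarith
    have h2 : E ≤ 1 + E := by linarith
    have h3 : A * A ≤ (A + 1) * (A + 1) := by nlinarith
    have h4 : E * E ^ 2 ≤ (1 + E) * (A + 1 + E) ^ 2 := mul_le_mul h2 h1 (by positivity) (by positivity)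
    calc E ^ 2 * A * (A * E) = A * A * (E * E ^ 2) := by ring
      _ ≤ (A + 1) * (A + 1) * ((1 + E) * (A + 1 + E) ^ 2) :=
          mul_le_mul h3 h4 (by positivity) (by positivity)
  · -- `x < t`: `e^{-c(t-x)} = E/(A+1)`
    have habs : |x - t| = t - x := by rw [abs_sub_comm]; exact abs_of_pos (by linarith)
    have hexp : Real.exp (-(c * |x - t|)) = E / (A + 1) := by
      rw [habs, show -(c * (t - x)) = c * x - c * t by ring, Real.exp_sub, hAt]
    rw [hexp, div_mul_div_comm, div_le_div_iff₀ (by positivity) (by positivity)]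
    have h1 : A ^ 2 ≤ (A + 1 + E) ^ 2 := by nlinarith
    have h2 : E ≤ 1 + E := by linarith
    calc E ^ 2 * A * (A * (A + 1)) = (A + 1) * E * (E * A ^ 2) := by ring
      _ ≤ (A + 1) * E * ((1 + E) * (A + 1 + E) ^ 2) := by
          apply mul_le_mul_of_nonneg_left _ (by positivity)
          exact mul_le_mul h2 h1 (by positivity) (by positivity)

/-! ### Masses -/

/-- **Total mass one**: `∫_{x<0} ρ₀ + 2∫ ρ₁ = 1` (the boundary measure is a probability measure:
`π⁻¹ ∫ dσ/(1+σ²) = 1`). [cite: BourgainDyatlov2018, §2.4] -/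
theorem densities_total_mass :
    (∫ x in Iio 0, rayDensity r t x) + ((∫ x, lineDensity r t x) + ∫ x, lineDensity r t x) = 1 := by
  have h := hpAverage_eq_densities hr ht (fun _ => (1 : ℝ))
    (by simpa using integrable_inv_one_add_sq)
  simp only [mul_one, one_div] at h
  rw [integral_univ_inv_one_add_sq, inv_mul_cancel₀ Real.pi_pos.ne'] at h
  exact h.symm

/-- **Lower bound for the mass of the segment `[-ℓ, 0)` of the ray** (BD18 Lemma 2.15, explicit
form): for `0 < r ≤ 1`, `0 < t ≤ 1`, `ℓ > 0`,
`∫_{[-ℓ,0)} ρ₀ ≥ (2π)⁻¹ (1 - e^{-πℓ})^{1/2} e^{-π/(2r)}`. [cite: BourgainDyatlov2018, Lemma 2.15] -/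
theorem le_setIntegral_rayDensity (hr1 : r ≤ 1) (ht1 : t ≤ 1) {ℓ : ℝ} (hℓ : 0 < ℓ) :
    (2 * π)⁻¹ * (Real.sqrt (1 - Real.exp (-(π * ℓ))) * Real.exp (-(π / (2 * r)))) ≤
      ∫ x in Ico (-ℓ) 0, rayDensity r t x := by
  have hA := slitStripA_pos hr ht
  set c : ℝ := π / r with hc
  have hc0 : 0 < c := by positivity
  have hcπ : π ≤ c := by rw [hc, le_div_iff₀ hr]; nlinarith [Real.pi_pos]
  -- the test function: indicator of the real segment `[-ℓ, 0)`
  set u : ℂ → ℝ := fun z => if z.im = 0 ∧ z.re ∈ Ico (-ℓ) 0 then 1 else 0 with hu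
  have hu01 : ∀ z, 0 ≤ u z ∧ u z ≤ 1 := fun z => by
    simp only [hu]; split_ifs <;> norm_num
  have humeas : Measurable u := by
    refine Measurable.ite ?_ measurable_const measurable_const
    exact (measurableSet_eq_fun Complex.measurable_im measurable_const).inter
      (measurableSet_Ico.preimage Complex.measurable_re)
  -- integrability of `u(β σ)/(1+σ²)`
  have hint : Integrable (fun σ => u (hpBdry r t σ) / (1 + σ ^ 2)) := by
    refine Integrable.mono' integrable_inv_one_add_sq
      ((humeas.comp measurable_hpBdry).div
        (measurable_const.add (measurable_id.pow_const 2))).aestronglyMeasurable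
      (Filter.Eventually.of_forall fun σ => ?_)
    have hpos : 0 < 1 + σ ^ 2 := by positivity
    rw [Real.norm_eq_abs, abs_div, abs_of_pos hpos, abs_of_nonneg (hu01 _).1]
    exact div_le_div_of_nonneg_right (hu01 _).2 hpos.le |>.trans (by rw [one_div])
  have hid := hpAverage_eq_densities hr ht u hint
  -- the line terms vanish, the ray term is the segment mass
  have hline : ∀ s : ℝ, (s = 1 ∨ s = -1) →
      (fun x : ℝ => lineDensity r t x * u ((x : ℂ) + (s * r : ℝ) * Complex.I)) = fun _ => 0 := by
    intro s hs; funext x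
    have hs0 : s ≠ 0 := by rcases hs with h | h <;> simp [h]
    simp [hu, hs0, hr.ne']
  have hl1 := hline 1 (Or.inl rfl)
  have hl2 := hline (-1) (Or.inr rfl)
  simp only [one_mul, Complex.ofReal_neg, neg_mul, ← sub_eq_add_neg] at hl1 hl2
  have hray : (fun x : ℝ => rayDensity r t x * u x) =
      fun x => (Ico (-ℓ) 0).indicator (rayDensity r t) x := by
    funext x
    simp only [hu, Complex.ofReal_im, Complex.ofReal_re, true_and, Set.indicator_apply]
    split_ifs <;> simp
  rw [hl1, hl2, hray, integral_zero, add_zero, add_zero,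
    integral_indicator measurableSet_Ico, Measure.restrict_restrict measurableSet_Ico,
    show Ico (-ℓ) 0 ∩ Iio 0 = Ico (-ℓ) 0 from
      Set.inter_eq_left.2 fun x hx => hx.2] at hid
  rw [← hid]
  -- lower bound for the half-plane integral over `σ ∈ (0, s₀)`
  set s₀ : ℝ := Real.sqrt ((1 - Real.exp (-(π * ℓ))) * Real.exp (-(π / r))) with hs₀
  have hm0 : 0 < 1 - Real.exp (-(π * ℓ)) := by
    have : Real.exp (-(π * ℓ)) < 1 := by
      rw [← Real.exp_zero]; exact Real.exp_lt_exp.2 (by nlinarith [Real.pi_pos])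
    linarith
  have hm1 : 1 - Real.exp (-(π * ℓ)) ≤ 1 := by linarith [Real.exp_pos (-(π * ℓ))]
  have hs₀pos : 0 < s₀ := Real.sqrt_pos.2 (mul_pos hm0 (Real.exp_pos _))
  have hs₀sq : s₀ ^ 2 = (1 - Real.exp (-(π * ℓ))) * Real.exp (-(π / r)) :=
    Real.sq_sqrt (mul_pos hm0 (Real.exp_pos _)).le
  have hs₀le : s₀ ≤ 1 := by
    rw [hs₀, Real.sqrt_le_one]
    calc (1 - Real.exp (-(π * ℓ))) * Real.exp (-(π / r)) ≤ 1 * 1 := by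
          apply mul_le_mul hm1 _ (Real.exp_pos _).le zero_le_one
          rw [Real.exp_le_one_iff]
          have hπr : 0 < π / r := by positivity
          linarith
      _ = 1 := one_mul _
  -- on `(0, s₀)`: `u(β σ) = 1`
  have hAs : slitStripA r t * s₀ ^ 2 ≤ 1 - Real.exp (-(c * ℓ)) := by
    have hA1 : slitStripA r t ≤ Real.exp (π / r) := by
      unfold slitStripA
      have : Real.exp (π * t / r) ≤ Real.exp (π / r) := Real.exp_le_exp.2 (by
        rw [div_le_div_iff_of_pos_right hr]; nlinarith [Real.pi_pos])
      linarith
    have hcl : Real.exp (-(c * ℓ)) ≤ Real.exp (-(π * ℓ)) := Real.exp_le_exp.2 (by nlinarith)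
    calc slitStripA r t * s₀ ^ 2 ≤ Real.exp (π / r) * s₀ ^ 2 :=
          mul_le_mul_of_nonneg_right hA1 (sq_nonneg _)
      _ = 1 - Real.exp (-(π * ℓ)) := by
          rw [hs₀sq, Real.exp_neg (π / r)]; field_simp
      _ ≤ 1 - Real.exp (-(c * ℓ)) := by linarith
  have hone : ∀ σ ∈ Ioo 0 s₀, u (hpBdry r t σ) = 1 := by
    intro σ hσ
    have hσ2 : slitStripA r t * σ ^ 2 ≤ slitStripA r t * s₀ ^ 2 :=
      mul_le_mul_of_nonneg_left (pow_le_pow_left₀ hσ.1.le hσ.2.le 2) hA.le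
    have hP0 : 0 < 1 - slitStripA r t * σ ^ 2 := by
      have := Real.exp_pos (-(c * ℓ)); linarith
    have hP1 : 1 - slitStripA r t * σ ^ 2 < 1 := by
      have : 0 < slitStripA r t * σ ^ 2 := mul_pos hA (pow_pos hσ.1 2); linarith
    have hlog0 : Real.log (1 - slitStripA r t * σ ^ 2) < 0 := Real.log_neg hP0 hP1
    have hlogℓ : -(c * ℓ) ≤ Real.log (1 - slitStripA r t * σ ^ 2) := by
      rw [← Real.log_exp (-(c * ℓ))]
      exact Real.log_le_log (Real.exp_pos _) (by linarith)
    have hre : (hpBdry r t σ).re = r / π * Real.log (1 - slitStripA r t * σ ^ 2) := by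
      unfold hpBdry; rw [if_pos hP0]; simp
    have him : (hpBdry r t σ).im = 0 := by
      unfold hpBdry; rw [if_pos hP0]; simp
    simp only [hu, him, hre, true_and, mem_Ico]
    rw [if_pos]
    constructor
    · -- `-ℓ ≤ (r/π) log(..)` from `log ≥ -cℓ = -(π/r)ℓ`
      have : r / π * (-(c * ℓ)) = -ℓ := by rw [hc]; field_simp
      rw [← this]
      exact mul_le_mul_of_nonneg_left hlogℓ (by positivity)
    · exact mul_neg_of_pos_of_neg (by positivity) hlog0
  -- compare integrals
  have hlow : ∫ σ, (Ioo 0 s₀).indicator (fun _ => (1 + s₀ ^ 2)⁻¹) σ ≤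
      ∫ σ, u (hpBdry r t σ) / (1 + σ ^ 2) := by
    apply integral_mono ((integrable_indicator_iff measurableSet_Ioo).2
      (integrableOn_const (by simp))) hint
    intro σ
    simp only [Set.indicator_apply]
    split_ifs with hσ
    · rw [hone σ hσ, one_div]
      apply inv_anti₀ (by positivity)
      nlinarith [hσ.1, hσ.2]
    · exact div_nonneg (hu01 _).1 (by positivity)
  rw [integral_indicator measurableSet_Ioo, setIntegral_const, smul_eq_mul,
    Real.volume_real_Ioo_of_le hs₀pos.le, sub_zero] at hlow
  -- `s₀/(1+s₀²) ≥ s₀/2` and `s₀ = (1-e^{-πℓ})^{1/2} e^{-π/(2r)}`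
  have hs₀eq : s₀ = Real.sqrt (1 - Real.exp (-(π * ℓ))) * Real.exp (-(π / (2 * r))) := by
    rw [hs₀, Real.sqrt_mul hm0.le]
    congr 1
    rw [Real.sqrt_eq_iff_mul_self_eq_of_pos (Real.exp_pos _), ← Real.exp_add]
    congr 1
    field_simp
    ring
  calc (2 * π)⁻¹ * (Real.sqrt (1 - Real.exp (-(π * ℓ))) * Real.exp (-(π / (2 * r))))
      = π⁻¹ * (s₀ / 2) := by rw [← hs₀eq]; field_simp
    _ ≤ π⁻¹ * (s₀ * (1 + s₀ ^ 2)⁻¹) := by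
        apply mul_le_mul_of_nonneg_left _ (by positivity)
        rw [div_eq_mul_inv]
        apply mul_le_mul_of_nonneg_left _ hs₀pos.le
        apply inv_anti₀ (by positivity)
        nlinarith
    _ ≤ π⁻¹ * ∫ σ, u (hpBdry r t σ) / (1 + σ ^ 2) :=
        mul_le_mul_of_nonneg_left hlow (by positivity)

/-! ### Measurability and the bounds in non-squared form -/

omit hr ht in
/-- `ρ₀` is measurable. [folklore] -/
theorem measurable_rayDensity : Measurable (rayDensity r t) := by
  unfold rayDensity rayParam
  fun_prop

omit hr ht in
/-- `ρ₁` is continuous. [folklore] -/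
theorem measurable_lineDensity : Measurable (lineDensity r t) := by
  unfold lineDensity lineParam
  fun_prop

/-- `ρ₁(x) ≤ (2r)⁻¹ (1 - e^{-ct})^{-1/2} e^{-c|x-t|/2}`, `c = π/r`.
[cite: BourgainDyatlov2018, Lemma 2.14] -/
theorem lineDensity_le (x : ℝ) :
    lineDensity r t x ≤ 1 / (2 * r) * (Real.sqrt (1 - Real.exp (-(π / r * t))))⁻¹ *
      Real.exp (-(π / r * |x - t| / 2)) := by
  have h := lineDensity_sq_le hr ht x
  have hm : 0 < 1 - Real.exp (-(π / r * t)) := by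
    have : Real.exp (-(π / r * t)) < 1 := by
      rw [← Real.exp_zero]; apply Real.exp_lt_exp.2
      have : 0 < π / r * t := by positivity
      linarith
    linarith
  have hrhs : (1 / (2 * r) * (Real.sqrt (1 - Real.exp (-(π / r * t))))⁻¹ *
      Real.exp (-(π / r * |x - t| / 2))) ^ 2 =
      (1 / (2 * r)) ^ 2 * (1 - Real.exp (-(π / r * t)))⁻¹ * Real.exp (-(π / r * |x - t|)) := by
    rw [mul_pow, mul_pow, inv_pow, Real.sq_sqrt hm.le, ← Real.exp_nat_mul]
    congr 1; push_cast; ring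
  rw [← hrhs] at h
  exact le_of_pow_le_pow_left₀ two_ne_zero (by positivity) h

/-- `ρ₀(x) ≤ r⁻¹ (ct(1 - e^{-cℓ}))^{-1/2} e^{cx}` for `x ≤ -ℓ < 0`, `c = π/r`.
[cite: BourgainDyatlov2018, §2.4] -/
theorem rayDensity_le_exp {ℓ x : ℝ} (hℓ : 0 < ℓ) (hx : x ≤ -ℓ) :
    rayDensity r t x ≤ 1 / r * (Real.sqrt (π / r * t * (1 - Real.exp (-(π / r * ℓ)))))⁻¹ *
      Real.exp (π / r * x) := by
  have h := rayDensity_sq_le_exp hr ht hℓ hx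
  have hm : 0 < π / r * t * (1 - Real.exp (-(π / r * ℓ))) := by
    apply mul_pos (by positivity)
    have : Real.exp (-(π / r * ℓ)) < 1 := by
      rw [← Real.exp_zero]; apply Real.exp_lt_exp.2
      have : 0 < π / r * ℓ := by positivity
      linarith
    linarith
  have hrhs : (1 / r * (Real.sqrt (π / r * t * (1 - Real.exp (-(π / r * ℓ)))))⁻¹ *
      Real.exp (π / r * x)) ^ 2 =
      Real.exp (π / r * x) ^ 2 / (r ^ 2 * (π / r * t * (1 - Real.exp (-(π / r * ℓ))))) := by
    rw [mul_pow, mul_pow, inv_pow, Real.sq_sqrt hm.le]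
    field_simp
  rw [← hrhs] at h
  exact le_of_pow_le_pow_left₀ two_ne_zero (by positivity) h

end bounds

end Literature.Analysis.Complex
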